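import Literature.MathematicalPhysics.QuantumFieldTheory.Balaban1983to89.B6HolderTermMultiLevelBox
import Literature.MathematicalPhysics.QuantumFieldTheory.Balaban1983to89.B6Prop22HolderTwoLevelBoxRateUnif

/-!
# `Balaban1983to89.B6HolderTermMultiLevelBoxRateUnif` — one cube term of the Hölder-weighted mixed difference of `G′₀`
# for the genuine `k`-level operator (p21's `…B6HolderTermMultiLevelBox.aX_dd_le`) WITH THE RATE UNIFORM IN THE HÖLDER
# EXPONENT: `∃ δ₄ ∀ α ∈ [0,1) ∃ Q(α)` — file 1 of the `k`-level `_unif` re-threading (print's quantifier order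
# [3] p.573 «δ₀, c₀, R₀ … depending on d, M only, c₀ on α also»)

statement-level skeleton of published theorems with citation tags; proofs where landed; nothing here is a claim about the Yang–Mills mass gap

T. Bałaban, *Propagators and renormalization transformations for lattice gauge theories. II*, Commun. Math. Phys. **96**
(1984) 223–250 [Balaban1984PropagatorsII], (2.64)–(2.67) p. 234, (2.43) p. 230; [3] = *Regularity and decay of lattice
Green's functions*, Commun. Math. Phys. **89** (1983) 571–597 [Balaban1983RegularityDecay], Theorem (1.9) p. 573 (the
quantifier order: «There exist positive constants δ₀, c₀, R₀ independent of A, k, Ω and depending on d, M only, c₀ on α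
also»).

CITATION HEADER (lean-in-tree rule).  Cell `lit-balaban` (HOME `run/shared/lean/pub/lit-balaban/`), unit `lit-balaban-r03`
gen 13 (B6 fold owner, own lane), SKELETON row **B6.Prop2.2**.  This is the `k`-LEVEL continuation of the two-level `_unif`
chain (`…B4Lemma24HolderRateUnif` → `…B4Thm19ZeroBoxHolderRateUnif` → `…B6Prop22HolderTwoLevelBoxRateUnif`, whose
`ineq243_twoLevel_holder_wsum2_unif` is the cube input consumed here).  The statement and the proof are p21 g11's
`…B6HolderTermMultiLevelBox.aX_dd_le` VERBATIM with the two ∃-witnesses reordered (`δ₄` before `α`, `Q` after): the rate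
`δ₄ = min(δ″, δ_d, δ_H, δ₃)` is a minimum of `α`-free rates once the cube Hölder clause is taken in its `_unif` form; only
the constant `Q` sees `c_H(α)`.  Everything else (`aX_dd_near_le`, `aX_diff_le`, the cube inputs `ineq243_twoLevel_roww` /
`_deriv_wsum`, the geometry) is consumed BY NAME from p21's files; four private plumbing lemmas of the source
(`exp_rate_mono`, `rpow_far_le`, `aX_apply_eq_zero`, `lev_window_of_uX_or`) are copied verbatim (private there).
THEOREMS ONLY; no definition, no `def … : Prop` fact; nothing existing modified.

WHAT THIS FILE PROVES (kernel-checked; 0 sorry): `aX_dd_le_unif` — `∃ δ₄ > 0 ∀ α ∈ [0,1) ∃ Q > 0`: for every member `□`,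
every pair `x ≠ x′` of one block `B^j(y)` with `x+e_μ`, `x′+e_μ` in the box, every `λ` supported in `B^{j′}(y′)` with
`|λ| ≤ B`: `|x′−x|_∞^{−α}·|dd_μ(h_□G′(□)v_□λ)(x, x′)| ≤ (L^j)^{1−α}·Q·e^{−δ₄d(y,y′)/(d+1)}·B`.
HONEST SCOPE: as `…B6HolderTermMultiLevelBox` (lattice units, Neumann box, reading R2 of (2.46), windows on the weights);
the uniformity in `α` is the PRINTED quantifier order, realised by re-threading, no new estimate.  NOT summit progress.
-/

namespace Literature.MathematicalPhysics.QuantumFieldTheory.Balaban1983to89.B6HolderTermMultiLevelBoxRateUnif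


open Finset Matrix
open Literature.MathematicalPhysics.QuantumFieldTheory.Balaban1983to89.B4ContourShift (supNorm supNorm_nonneg
  abs_le_supNorm exists_supNorm_eq)
open Literature.MathematicalPhysics.QuantumFieldTheory.Balaban1983to89.B4Reflection242 (boxDom mem_boxDom blk nbrs
  mem_nbrs)
open Literature.MathematicalPhysics.QuantumFieldTheory.Balaban1983to89.B4Lemma22ReduceZero (Box)
open Literature.MathematicalPhysics.QuantumFieldTheory.Balaban1983to89.B4PartitionUnity22 (hprof D1 D2 D1_nonneg D2_nonneg
  contDiff_hprof hasCompactSupport_hprof)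
open Literature.MathematicalPhysics.QuantumFieldTheory.Balaban1983to89.B4Thm110ZeroBox (boxCast boxCast_apply_val
  boxCast_symm_apply_val mem_boxDom_of_eq roww mulVec_le_of_roww supNorm_sub_le_sub_add_sub)
open Literature.MathematicalPhysics.QuantumFieldTheory.Balaban1983to89.B4Thm110ZeroBoxDeriv (wsum supNorm_single_le
  supNorm_sub_le_nbr)
open Literature.MathematicalPhysics.QuantumFieldTheory.Balaban1983to89.B6Ineq243TwoLevelBox
open Literature.MathematicalPhysics.QuantumFieldTheory.Balaban1983to89.B6Partition236TwoLevelBox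
open Literature.MathematicalPhysics.QuantumFieldTheory.Balaban1983to89.B6Eq238TwoLevelBox
open Literature.MathematicalPhysics.QuantumFieldTheory.Balaban1983to89.B6Ineq249TwoLevelBox (near card_near_le
  mem_near_of_abs_lt emb_sub_emb)
open Literature.MathematicalPhysics.QuantumFieldTheory.Balaban1983to89.B6MultiLevelBoxOperator
open Literature.MathematicalPhysics.QuantumFieldTheory.Balaban1983to89.B6Eq238MultiLevelBox
open Literature.MathematicalPhysics.QuantumFieldTheory.Balaban1983to89.B6Ineq249MultiLevelBox
open Literature.MathematicalPhysics.QuantumFieldTheory.Balaban1983to89.B6Geom246MultiLevelBox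
open Literature.MathematicalPhysics.QuantumFieldTheory.Balaban1983to89.B6Prop22MultiLevelBox
open Literature.MathematicalPhysics.QuantumFieldTheory.Balaban1983to89.B6Prop22DerivMultiLevelBox (dMat
  dMat_mulVec_of_mem img_of_uX_ne_zero mem_keySet_of_uX_ne_zero)
open Literature.MathematicalPhysics.QuantumFieldTheory.Balaban1983to89.B6Prop22HolderTwoLevelBox (exists_emb_eq_of_near
  abs_hq_dd_le wsum_longDiff_le)
open Literature.MathematicalPhysics.QuantumFieldTheory.Balaban1983to89.B6Ineq243HolderTwoLevelBox
  (ineq243_twoLevel_holder_wsum2)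
open Literature.MathematicalPhysics.QuantumFieldTheory.Balaban1983to89.B6RandomWalk (HasMajorant BlockSupp
  hasMajorant_mono)
open Literature.MathematicalPhysics.QuantumFieldTheory.Balaban1983to89.B6Ineq261LevelGap (K261 K261_nonneg
  theta_lt_one_of_log)
open Literature.MathematicalPhysics.QuantumFieldTheory.Balaban1983to89.B6Prop23Chain (majorant_of_fixedPoint_266W)
open Literature.MathematicalPhysics.QuantumFieldTheory.Balaban1983to89.B6HolderTermMultiLevelBox
open Literature.MathematicalPhysics.QuantumFieldTheory.Balaban1983to89.B6Prop22HolderTwoLevelBoxRateUnif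
  (ineq243_twoLevel_holder_wsum2_unif)

noncomputable section

variable {d : ℕ}

/-! ## §1 Private plumbing copied verbatim from `…B6HolderTermMultiLevelBox` (private there) -/

section Tools

/-- the weakening of a rate against a non-negative distance (verbatim private copy from `…B6HolderTermMultiLevelBox`). [folklore] -/
private theorem exp_rate_mono {δ δ' dist : ℝ} (hδ : δ' ≤ δ) (hdist : 0 ≤ dist) (d : ℕ) :
    Real.exp (-(δ / (d + 1) * dist)) ≤ Real.exp (-(δ' / (d + 1) * dist)) := by
  rw [Real.exp_le_exp, neg_le_neg_iff]
  exact mul_le_mul_of_nonneg_right (div_le_div_of_nonneg_right hδ (by positivity)) hdist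


/-- Hölder weights, far pairs: `s^{−α}·T ≤ L·T^{1−α}` when `T ≤ L·n`, `n ≤ s`, `0 ≤ α ≤ 1`, `L ≥ 1`, `n, T > 0`.
[folklore] -/
private theorem rpow_far_le {n s T L α : ℝ} (hn : 0 < n) (hns : n ≤ s) (hT : 0 < T) (hTL : T ≤ L * n)
    (hL : 1 ≤ L) (hα0 : 0 ≤ α) (hα1 : α ≤ 1) : s ^ (-α) * T ≤ L * T ^ (1 - α) := by
  have hL0 : 0 < L := by linarith
  -- `s^{−α} ≤ n^{−α} ≤ (T/L)^{−α} = L^{α}·T^{−α} ≤ L·T^{−α}`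
  have h1 : s ^ (-α) ≤ n ^ (-α) := Real.rpow_le_rpow_of_nonpos hn hns (by linarith)
  have hTLn : T / L ≤ n := by rw [div_le_iff₀ hL0]; linarith
  have h2 : n ^ (-α) ≤ (T / L) ^ (-α) := Real.rpow_le_rpow_of_nonpos (div_pos hT hL0) hTLn (by linarith)
  have h3 : (T / L) ^ (-α) = L ^ α * T ^ (-α) := by
    rw [Real.div_rpow hT.le hL0.le, Real.rpow_neg hT.le, Real.rpow_neg hL0.le]
    field_simp
  have h4 : L ^ α ≤ L := B4Thm19ZeroBoxHolder.rpow_le_self_of_one_le hL hα1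
  have h5 : T ^ (-α) * T = T ^ (1 - α) := by
    rw [show (1 : ℝ) - α = -α + 1 by ring, Real.rpow_add hT, Real.rpow_one]
  have hTα : 0 ≤ T ^ (-α) := Real.rpow_nonneg hT.le _
  calc s ^ (-α) * T ≤ L ^ α * T ^ (-α) * T := by
        refine mul_le_mul_of_nonneg_right (h1.trans (h2.trans h3.le)) hT.le
    _ ≤ L * T ^ (-α) * T := by gcongr
    _ = L * T ^ (1 - α) := by rw [mul_assoc, h5]

end Tools

section OneTerm

variable {ℓ Mh k R : ℕ} {P : Fin (d + 1) → ℕ} {D : Domains d ℓ Mh k P R} {a c : ℕ → ℝ}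

/-- the value of a cube term vanishes where its cut-off does. [cite: Balaban1984PropagatorsII, (2.37) p.229, dictionary] -/
private theorem aX_apply_eq_zero (hP : ∀ μ, 1 ≤ P μ) (cq : ℕ × (Fin (d + 1) → ℤ)) (hc : CubeData D cq)
    (lam : ↥(boxDom (N0 ℓ Mh k P)) → ℝ) {z : ↥(boxDom (N0 ℓ Mh k P))}
    (hz : uX (ℓ := ℓ) (Mh := Mh) (k := k) (P := P) cq z = 0) : (aX D a c hP cq hc *ᵥ lam) z = 0 := by
  rw [aX_mulVec_apply, hz, zero_mul]

/-- a site where a cube term's bond difference is non-trivial lies in the cube: its level is in the window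
`[i_□, i_□ + 1]`. [cite: Balaban1984PropagatorsII, (2.2) p.224 with p.230; Balaban1983RegularityDecay, (2.6) p.576] -/
private theorem lev_window_of_uX_or (hℓ : 1 ≤ ℓ) (hR : 2 * (ℓ + 1) ≤ R) (hP : ∀ μ, 1 ≤ P μ) (hMh : 1 ≤ Mh)
    (cq : ℕ × (Fin (d + 1) → ℤ)) (hc : CubeData D cq) {μ : Fin (d + 1)} (x : ↥(boxDom (N0 ℓ Mh k P)))
    (hxe : x.1 + Pi.single μ 1 ∈ boxDom (N0 ℓ Mh k P))
    (hu : uX (ℓ := ℓ) (Mh := Mh) (k := k) (P := P) cq x ≠ 0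
      ∨ uX (ℓ := ℓ) (Mh := Mh) (k := k) (P := P) cq ⟨x.1 + Pi.single μ 1, hxe⟩ ≠ 0) :
    fin D cq.1 cq.2 ≤ D.lev x.1 ∧ D.lev x.1 ≤ fin D cq.1 cq.2 + 1 := by
  obtain ⟨hi1, hij, hji, -, -⟩ := fin_data hc
  have hjk := hc.hj.2
  have hx_nb : x.1 ∈ nbrs (⟨x.1 + Pi.single μ 1, hxe⟩ : ↥(boxDom (N0 ℓ Mh k P))).1 :=
    mem_nbrs.2 ⟨μ, Or.inr (by rw [add_sub_cancel_right])⟩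
  obtain ⟨y, hy⟩ : ∃ y, embC D hP cq hc y = (castP (ℓ := ℓ) (Mh := Mh) (P := P) hij hjk).symm x := by
    rcases hu with h | h
    · exact img_of_uX_ne_zero hℓ hP hMh cq hc h (Or.inr rfl)
    · exact img_of_uX_ne_zero hℓ hP hMh cq hc h (Or.inl hx_nb)
  have hzval : ((castP (ℓ := ℓ) (Mh := Mh) (P := P) hij hjk).symm x).1 = x.1 := by
    unfold castP; exact boxCast_symm_apply_val _ _
  have hxin : InCube ℓ Mh k P cq.1 cq.2 x.1 := by
    rw [← hzval]; exact (inCube_iff_exists_emb (Mh := Mh) hP hij hc.hq _).2 ⟨y, hy⟩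
  exact lev_window_of_inCube hℓ hR hP hMh hc x.2 hxin

/-! ## §2 The one-term Hölder mixed difference with the rate uniform in `α` -/

/-- **ONE TERM OF THE HÖLDER-WEIGHTED MIXED DIFFERENCE OF `G′₀`, RATE UNIFORM IN `α`** (the `_unif` twin of
`…B6HolderTermMultiLevelBox.aX_dd_le`, print's quantifier order): there is `δ₄ > 0` (function of `d`, `ℓ`, the windows) and for
every `0 ≤ α < 1` a `Q > 0` (also depending on `α`) such that for every member `□` of the cover, every pair `x ≠ x′` of one block `B^j(y)` with `x + e_μ`,
`x′ + e_μ` in the box and every `λ` supported in the block `y′` with `|λ| ≤ B`: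
`|x′−x|_∞^{−α}·|((h_□G′(□)v_□λ)(x′+e_μ) − (…)(x′)) − ((…)(x+e_μ) − (…)(x))| ≤ (L^{j})^{1−α}·Q·e^{−δ₄d(y,y′)/(d+1)}·B` —
near pairs (`|x′−x|_∞ + 1 ≤ 2L^{i_□}`) by the four-term product rule of §5 with the three cube inputs
(`B6Ineq243TwoLevelBox.ineq243_twoLevel_roww/_deriv_wsum`, `B6Ineq243HolderTwoLevelBox.ineq243_twoLevel_holder_wsum2`),
far pairs by two single bond differences (file 6, `aX_diff_le`) and `|x′−x|^{−α}L^{j} ≤ L·(L^{j})^{1−α}`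
(`L^{j} ≤ L·L^{i_□} ≤ L|x′−x|`). [cite: Balaban1984PropagatorsII, (2.64)–(2.67) p.234 («(L^jη)² replaced by … (L^jη)^{1−α}»), (2.43) p.230; Balaban1983RegularityDecay, Theorem (1.9) p.573] -/
theorem aX_dd_le_unif (d ℓ : ℕ) (hℓ : 1 ≤ ℓ) (aminus aplus a2minus a2plus : ℝ) (ha : 0 < aminus) (ha2 : 0 < a2minus) :
    ∃ δ₄ : ℝ, 0 < δ₄ ∧ ∀ (α : ℝ), 0 ≤ α → α < 1 → ∃ Q : ℝ, 0 < Q ∧ ∀ (k Mh R : ℕ), 3 ≤ Mh → 2 * (ℓ + 1) ≤ R →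
      ∀ (P : Fin (d + 1) → ℕ) (hP : ∀ μ, 1 ≤ P μ) (D : Domains d ℓ Mh k P R) (a c : ℕ → ℝ),
        (∀ i, 1 ≤ i → aminus ≤ a i ∧ a i ≤ aplus) → (∀ i, 1 ≤ i → a2minus ≤ c i ∧ c i ≤ a2plus) →
        ∀ (μ : Fin (d + 1)) (y' : ↥(bset D)) (lam : ↥(boxDom (N0 ℓ Mh k P)) → ℝ) (B : ℝ),
          BlockSupp (g := geom D) (blkOf D) lam y' B →
          ∀ (x x' : ↥(boxDom (N0 ℓ Mh k P))), x'.1 ≠ x.1 → blkOf D x' = blkOf D x →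
          ∀ (hxe : x.1 + Pi.single μ 1 ∈ boxDom (N0 ℓ Mh k P)) (hxe' : x'.1 + Pi.single μ 1 ∈ boxDom (N0 ℓ Mh k P))
            (cq : ℕ × (Fin (d + 1) → ℤ)) (hc : CubeData D cq),
            (supNorm (x'.1 - x.1)) ^ (-α)
                * |((aX D a c hP cq hc *ᵥ lam) ⟨x'.1 + Pi.single μ 1, hxe'⟩ - (aX D a c hP cq hc *ᵥ lam) x')
                    - ((aX D a c hP cq hc *ᵥ lam) ⟨x.1 + Pi.single μ 1, hxe⟩ - (aX D a c hP cq hc *ᵥ lam) x)|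
              ≤ (((ℓ : ℝ) + 1) ^ D.lev x.1) ^ (1 - α)
                * (Q * Real.exp (-(δ₄ / (d + 1) * (geom D).dist (blkOf D x) y')) * B) := by
  obtain ⟨δ'', c', hδ'', hc', h243⟩ := ineq243_twoLevel_roww d ℓ hℓ aminus aplus 0 a2minus a2plus ha ha2
  obtain ⟨δd, cd, hδd, hcd, h243d⟩ := ineq243_twoLevel_deriv_wsum d ℓ hℓ aminus aplus 0 a2minus a2plus ha ha2
  obtain ⟨δH, hδH, hHU⟩ := ineq243_twoLevel_holder_wsum2_unif d ℓ hℓ aminus aplus 0 a2minus a2plus ha ha2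
  obtain ⟨δ₃, Q₃, hδ₃, hQ₃, hfar⟩ := aX_diff_le d ℓ hℓ aminus aplus a2minus a2plus ha ha2
  have hD1 := D1_nonneg contDiff_hprof hasCompactSupport_hprof
  have hD2 := D2_nonneg contDiff_hprof hasCompactSupport_hprof
  obtain ⟨δ₄, hδ₄⟩ : ∃ t : ℝ, t = min (min δ'' δd) (min δH δ₃) := ⟨_, rfl⟩
  have hδ₄pos : 0 < δ₄ := by rw [hδ₄]; exact lt_min (lt_min hδ'' hδd) (lt_min hδH hδ₃)
  have h41 : δ₄ ≤ δ'' := by rw [hδ₄]; exact (min_le_left _ _).trans (min_le_left _ _)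
  have h42 : δ₄ ≤ δd := by rw [hδ₄]; exact (min_le_left _ _).trans (min_le_right _ _)
  have h43 : δ₄ ≤ δH := by rw [hδ₄]; exact (min_le_right _ _).trans (min_le_left _ _)
  have h44 : δ₄ ≤ δ₃ := by rw [hδ₄]; exact (min_le_right _ _).trans (min_le_right _ _)
  refine ⟨δ₄, hδ₄pos, fun α hα0 hα1 => ?_⟩
  obtain ⟨cH, hcH, hH⟩ := hHU α hα0 hα1
  obtain ⟨Qn, hQn⟩ : ∃ t : ℝ, t = (D2 hprof + d * D1 hprof ^ 2) * (c' * (Real.exp δ'' * Real.exp δ''))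
      + (d + 1) * D1 hprof * (cd * (Real.exp δd * Real.exp δd))
      + (d + 1) * ((d + 1) * D1 hprof) * (cd * (Real.exp δd * Real.exp δd * (Real.exp δd * Real.exp δd)))
      + cH * (Real.exp δH * Real.exp δH) := ⟨_, rfl⟩
  have hQn0 : 0 ≤ Qn := by rw [hQn]; positivity
  refine ⟨Qn + 2 * ((ℓ : ℝ) + 1) * Q₃ + 1, by positivity, ?_⟩
  intro k Mh R hMh hR P hP D a c haw hcw μ y' lam B hlam x x' hne hblk hxe hxe' cq hc
  obtain ⟨hi1, hij, hji, -, -⟩ := fin_data hc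
  have hMh1 : 1 ≤ Mh := le_trans (by norm_num) hMh
  have hL1 : (1 : ℝ) ≤ (ℓ : ℝ) + 1 := by linarith [(Nat.cast_nonneg ℓ : (0 : ℝ) ≤ ℓ)]
  have hB0 : 0 ≤ B := hlam.nonneg
  have hdnn : 0 ≤ (geom D).dist (blkOf D x) y' := (triangle_refl_nonneg D hMh1 hP).2.2 _ _
  obtain ⟨E4, hE4⟩ : ∃ t : ℝ, t = Real.exp (-(δ₄ / (d + 1) * (geom D).dist (blkOf D x) y')) := ⟨_, rfl⟩
  rw [← hE4]
  have hE40 : 0 ≤ E4 := by rw [hE4]; exact (Real.exp_pos _).le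
  obtain ⟨LJ, hLJ⟩ : ∃ t : ℝ, t = ((ℓ : ℝ) + 1) ^ D.lev x.1 := ⟨_, rfl⟩
  rw [← hLJ]
  have hLJ0 : 0 < LJ := by rw [hLJ]; positivity
  have hLJα0 : 0 ≤ LJ ^ (1 - α) := Real.rpow_nonneg hLJ0.le _
  have hRHS0 : 0 ≤ LJ ^ (1 - α) * ((Qn + 2 * ((ℓ : ℝ) + 1) * Q₃ + 1) * E4 * B) := by positivity
  have hs1 : 1 ≤ supNorm (x'.1 - x.1) := B4StripSumsHolder.one_le_supNorm (sub_ne_zero.2 hne)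
  have hs0 : 0 < supNorm (x'.1 - x.1) := lt_of_lt_of_le one_pos hs1
  have hW0 : 0 ≤ (supNorm (x'.1 - x.1)) ^ (-α) := Real.rpow_nonneg hs0.le _
  -- the trivial case: the cut-off vanishes at the four points
  by_cases h0 : uX (ℓ := ℓ) (Mh := Mh) (k := k) (P := P) cq x = 0
      ∧ uX (ℓ := ℓ) (Mh := Mh) (k := k) (P := P) cq ⟨x.1 + Pi.single μ 1, hxe⟩ = 0
      ∧ uX (ℓ := ℓ) (Mh := Mh) (k := k) (P := P) cq x' = 0
      ∧ uX (ℓ := ℓ) (Mh := Mh) (k := k) (P := P) cq ⟨x'.1 + Pi.single μ 1, hxe'⟩ = 0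
  · rw [aX_apply_eq_zero hP cq hc lam h0.1, aX_apply_eq_zero hP cq hc lam h0.2.1, aX_apply_eq_zero hP cq hc lam h0.2.2.1,
      aX_apply_eq_zero hP cq hc lam h0.2.2.2]
    simp only [sub_self, abs_zero, mul_zero]
    exact hRHS0
  have hu : uX (ℓ := ℓ) (Mh := Mh) (k := k) (P := P) cq x ≠ 0
      ∨ uX (ℓ := ℓ) (Mh := Mh) (k := k) (P := P) cq ⟨x.1 + Pi.single μ 1, hxe⟩ ≠ 0
      ∨ uX (ℓ := ℓ) (Mh := Mh) (k := k) (P := P) cq x' ≠ 0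
      ∨ uX (ℓ := ℓ) (Mh := Mh) (k := k) (P := P) cq ⟨x'.1 + Pi.single μ 1, hxe'⟩ ≠ 0 := by
    by_contra h'; push Not at h'; exact h0 ⟨h'.1, h'.2.1, h'.2.2.1, h'.2.2.2⟩
  -- the level window at `x` (the level of `x′` is that of `x`)
  have hlevx' : D.lev x'.1 = D.lev x.1 := congrArg (fun s : ↥(bset D) => s.1.1) hblk
  have hwin : fin D cq.1 cq.2 ≤ D.lev x.1 ∧ D.lev x.1 ≤ fin D cq.1 cq.2 + 1 := by
    rcases hu with h | h | h | h
    · exact lev_window_of_uX_or hℓ hR hP hMh1 cq hc x hxe (Or.inl h)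
    · exact lev_window_of_uX_or hℓ hR hP hMh1 cq hc x hxe (Or.inr h)
    · rw [← hlevx']; exact lev_window_of_uX_or hℓ hR hP hMh1 cq hc x' hxe' (Or.inl h)
    · rw [← hlevx']; exact lev_window_of_uX_or hℓ hR hP hMh1 cq hc x' hxe' (Or.inr h)
  have hn1 : (1 : ℝ) ≤ (((ℓ + 1) ^ fin D cq.1 cq.2 : ℕ) : ℝ) := by exact_mod_cast Nat.one_le_pow _ _ (by omega)
  have hn0 : (0 : ℝ) < (((ℓ + 1) ^ fin D cq.1 cq.2 : ℕ) : ℝ) := lt_of_lt_of_le one_pos hn1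
  by_cases hnear : supNorm (x'.1 - x.1) + 1 ≤ 2 * (((ℓ + 1) ^ fin D cq.1 cq.2 : ℕ) : ℝ)
  · -- NEAR PAIRS: §5 with the three cube inputs of the lineage
    have hcM' : ∀ ν, 1 ≤ cubeM' (MhP ℓ Mh cq.1 (fin D cq.1 cq.2)) (Pj ℓ k P cq.1) cq.2 ν := fun ν =>
      Nat.one_le_iff_ne_zero.2 (Nat.mul_ne_zero_iff.2
        ⟨by have := one_le_MhP (ℓ := ℓ) hMh1 cq.1 (fin D cq.1 cq.2); omega,
          by have := (one_le_cubeW (one_le_Pj hP cq.1) hc.hq ν).1; omega⟩)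
    have key := aX_dd_near_le (D := D) (a := a) (c := c) hℓ hMh hR hP cq hc hα1.le (μ := μ) hδ₄pos h41 h42 h43
      hc'.le hcd.le hcH.le
      (fun b => h243 (fin D cq.1 cq.2) hi1 (a (fin D cq.1 cq.2)) 0 (c (fin D cq.1 cq.2)) (haw _ hi1).1 (haw _ hi1).2
        le_rfl le_rfl (hcw _ hi1).1 (hcw _ hi1).2 _ hcM' _ b)
      (fun i u ue hue => h243d (fin D cq.1 cq.2) hi1 (a (fin D cq.1 cq.2)) 0 (c (fin D cq.1 cq.2)) (haw _ hi1).1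
        (haw _ hi1).2 le_rfl le_rfl (hcw _ hi1).1 (hcw _ hi1).2 _ hcM' _ i u ue hue)
      (fun u ue u' ue' hue hue' hne' => hH (fin D cq.1 cq.2) hi1 (a (fin D cq.1 cq.2)) 0 (c (fin D cq.1 cq.2))
        (haw _ hi1).1 (haw _ hi1).2 le_rfl le_rfl (hcw _ hi1).1 (hcw _ hi1).2 _ hcM' _ μ u ue u' ue' hue hue' hne')
      y' lam B hlam x x' hne hblk hxe hxe' hnear hu
    rw [← hQn, ← hE4, ← hLJ] at key
    refine key.trans (mul_le_mul_of_nonneg_left ?_ hLJα0)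
    refine mul_le_mul_of_nonneg_right (mul_le_mul_of_nonneg_right ?_ hE40) hB0
    nlinarith [hQ₃.le, hL1]
  · -- FAR PAIRS: two single bond differences
    have hns : (((ℓ + 1) ^ fin D cq.1 cq.2 : ℕ) : ℝ) ≤ supNorm (x'.1 - x.1) := by
      push Not at hnear; linarith
    have hΔ := hfar k Mh R hMh hR P hP D a c haw hcw μ y' lam B hlam x hxe cq hc
    have hΔ' := hfar k Mh R hMh hR P hP D a c haw hcw μ y' lam B hlam x' hxe' cq hc
    rw [hblk, hlevx'] at hΔ'
    rw [← hLJ] at hΔ hΔ'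
    have he3 : Real.exp (-(δ₃ / (d + 1) * (geom D).dist (blkOf D x) y')) ≤ E4 := by
      rw [hE4]; exact exp_rate_mono h44 hdnn d
    have hT : LJ ≤ ((ℓ : ℝ) + 1) * (((ℓ + 1) ^ fin D cq.1 cq.2 : ℕ) : ℝ) := by
      rw [hLJ]; push_cast
      rw [← pow_succ']
      exact pow_le_pow_right₀ hL1 hwin.2
    have hWL : (supNorm (x'.1 - x.1)) ^ (-α) * LJ ≤ ((ℓ : ℝ) + 1) * LJ ^ (1 - α) :=
      rpow_far_le hn0 hns hLJ0 hT hL1 hα0 hα1.le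
    calc (supNorm (x'.1 - x.1)) ^ (-α)
          * |((aX D a c hP cq hc *ᵥ lam) ⟨x'.1 + Pi.single μ 1, hxe'⟩ - (aX D a c hP cq hc *ᵥ lam) x')
              - ((aX D a c hP cq hc *ᵥ lam) ⟨x.1 + Pi.single μ 1, hxe⟩ - (aX D a c hP cq hc *ᵥ lam) x)|
        ≤ (supNorm (x'.1 - x.1)) ^ (-α)
            * (LJ * (Q₃ * Real.exp (-(δ₃ / (d + 1) * (geom D).dist (blkOf D x) y')) * B)
              + LJ * (Q₃ * Real.exp (-(δ₃ / (d + 1) * (geom D).dist (blkOf D x) y')) * B)) :=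
          mul_le_mul_of_nonneg_left ((abs_sub _ _).trans (add_le_add hΔ' hΔ)) hW0
      _ = ((supNorm (x'.1 - x.1)) ^ (-α) * LJ)
            * (2 * Q₃ * Real.exp (-(δ₃ / (d + 1) * (geom D).dist (blkOf D x) y')) * B) := by ring
      _ ≤ (((ℓ : ℝ) + 1) * LJ ^ (1 - α)) * (2 * Q₃ * E4 * B) := by
          refine mul_le_mul hWL ?_ (by positivity) (by positivity)
          exact mul_le_mul_of_nonneg_right (mul_le_mul_of_nonneg_left he3 (by positivity)) hB0
      _ = LJ ^ (1 - α) * ((2 * ((ℓ : ℝ) + 1) * Q₃) * E4 * B) := by ring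
      _ ≤ LJ ^ (1 - α) * ((Qn + 2 * ((ℓ : ℝ) + 1) * Q₃ + 1) * E4 * B) := by
          refine mul_le_mul_of_nonneg_left ?_ hLJα0
          refine mul_le_mul_of_nonneg_right (mul_le_mul_of_nonneg_right (by linarith) hE40) hB0

end OneTerm

end

end Literature.MathematicalPhysics.QuantumFieldTheory.Balaban1983to89.B6HolderTermMultiLevelBoxRateUnif
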